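import Summits.HubbardSuperconductivity.HubbardSuperconductivity.Theorems.BirComplexStableXY.Negative.BirComplexStableXYFalseOfWitnessZeroExists

/-!
# Crux `BirComplexStableXYR` (item `stmt-HubbardSuperconductivity-14845`): the restated class has GENUINELY COMPLEX members

The restated engine quantifies over finite Fourier tables with (U1), (N), (A), (C) and the two new symmetry
hypotheses (R) `c (n ∘ R) = conj (c (−n))` (time-reflection Hermiticity) and (P) `c (n ∘ P) = c n` (inversion
evenness).  A natural worry for graders and provers is that (R)∧(P) might secretly shrink the class to REAL generating
functions `F` (then the crux would be a corollary of the real low-temperature theory and the route's "third engine"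
claim would be void).  It does not: the Berry-tilted XY table `witness 0 ε₂` of the landed negative module
(`Σ_{12 cube edges} (1 − cos Δ_eφ) + iε₂ Σ_{4 temporal edges} sin Δ_eφ`) satisfies ALL SIX hypotheses with
`B = 128`, `c₀ = 1/18` for `|ε₂| ≤ 1/5` (`tiltedXY_mem_classRP`), and its generating function is non-real as soon as
`ε₂ ≠ 0` (`genF_tiltedXY_not_real`: `Im F = 4ε₂` at `φ = π/2` on the later slice).  So the class of crux 2R is
inhabited by genuinely complex, time-odd actions — the non-vacuity half of the refuter protocol for this item — and
the standing disprover's inertness analysis of the tilt (workfile `Cruxes/BirComplexStableXYR/Disproof.lean` §4b(5),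
numerics j015276/j015307) is about an honest member of the class.  Elementary `Finsupp` bookkeeping; no definition is
introduced.  Standing disprover, cdisprove cycle 1, 2026-08-16. [folklore]
-/

namespace Summit.HubbardSuperconductivity.HubbardSuperconductivity.Theorems.BirComplexStableXYR.Negative

open scoped BigOperators ComplexConjugate
open Summit.HubbardSuperconductivity.BirComplexStableXYNegative

noncomputable section

/-- the time reflection of the `r = 2` window is an involution. -/
theorem rhoR_invol : ∀ w : W 2,
    (fun w : W 2 => ((w.1, w.2.1, Fin.rev w.2.2) : W 2)) ((fun w : W 2 => ((w.1, w.2.1, Fin.rev w.2.2) : W 2)) w) = w := by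
  decide
/-- the spatial inversion of the `r = 2` window is an involution. -/
theorem rhoP_invol : ∀ w : W 2,
    (fun w : W 2 => ((Fin.rev w.1, Fin.rev w.2.1, w.2.2) : W 2)) ((fun w : W 2 => ((Fin.rev w.1, Fin.rev w.2.1, w.2.2) : W 2)) w) = w := by
  decide

/-- evaluating a single Fourier mode at a reflected frequency (`ρ` an involution of the window). -/
theorem single_apply_comp {ρ : W 2 → W 2} (hρ : ∀ w, ρ (ρ w) = w) (f : Freq 2) (a : ℂ) (n : Freq 2) :
    Finsupp.single f a (fun w => n (ρ w)) = Finsupp.single (fun w => f (ρ w)) a n := by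
  simp only [Finsupp.single_apply]
  congr 1
  apply propext
  constructor
  · intro h; funext w; simp only [h, hρ]
  · intro h; funext w; rw [← h]; simp only [hρ]

/-- evaluating a single Fourier mode at the negated frequency. -/
theorem single_apply_neg (f : Freq 2) (a : ℂ) (n : Freq 2) :
    Finsupp.single f a (-n) = Finsupp.single (-f) a n := by
  simp only [Finsupp.single_apply, neg_eq_iff_eq_neg]

/-- reflecting the frequency of `φ_u − φ_v` gives the frequency of `φ_{ρu} − φ_{ρv}`. -/
theorem dfreq_comp {ρ : W 2 → W 2} (hρ : ∀ w, ρ (ρ w) = w) (u v : W 2) :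
    (fun w => dfreq u v (ρ w)) = dfreq (ρ u) (ρ v) := by
  funext w
  have h1 : (ρ w = u) ↔ (w = ρ u) := ⟨fun h => by rw [← h, hρ], fun h => by rw [h, hρ]⟩
  have h2 : (ρ w = v) ↔ (w = ρ v) := ⟨fun h => by rw [← h, hρ], fun h => by rw [h, hρ]⟩
  simp only [dfreq, Pi.sub_apply, Pi.single_apply, h1, h2]

/-- `−(δ_u − δ_v) = δ_v − δ_u`. -/
theorem neg_dfreq (u v : W 2) : -dfreq u v = dfreq v u := by
  simp [dfreq]

/-- the zero frequency is reflection invariant. -/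
theorem zero_comp {ρ : W 2 → W 2} : (fun w => (0 : Freq 2) (ρ w)) = 0 := rfl

/-- the `1 − cos` table evaluated at a reflected frequency. -/
theorem cosTab_apply_comp {ρ : W 2 → W 2} (hρ : ∀ w, ρ (ρ w) = w) (u v : W 2) (n : Freq 2) :
    cosTab u v (fun w => n (ρ w)) = cosTab (ρ u) (ρ v) n := by
  simp only [cosTab, Finsupp.add_apply, single_apply_comp hρ, dfreq_comp hρ, zero_comp]

/-- the `sin` table evaluated at a reflected frequency. -/
theorem sinTab_apply_comp {ρ : W 2 → W 2} (hρ : ∀ w, ρ (ρ w) = w) (u v : W 2) (n : Freq 2) :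
    sinTab u v (fun w => n (ρ w)) = sinTab (ρ u) (ρ v) n := by
  simp only [sinTab, Finsupp.add_apply, single_apply_comp hρ, dfreq_comp hρ]

/-- the `1 − cos` table is even in the frequency. -/
theorem cosTab_apply_neg (u v : W 2) (n : Freq 2) : cosTab u v (-n) = cosTab u v n := by
  simp only [cosTab, Finsupp.add_apply, single_apply_neg, neg_dfreq, neg_zero]
  simp only [Finsupp.single_apply]
  split_ifs <;> ring

/-- the `sin` table is odd in the frequency. -/
theorem sinTab_apply_neg (u v : W 2) (n : Freq 2) : sinTab u v (-n) = -sinTab u v n := by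
  simp only [sinTab, Finsupp.add_apply, single_apply_neg, neg_dfreq]
  simp only [Finsupp.single_apply]
  split_ifs <;> ring

/-- `1 − cos(φ_u − φ_v)` is symmetric in `u, v`. -/
theorem cosTab_comm (u v : W 2) : cosTab u v = cosTab v u := by
  simp only [cosTab]; abel

/-- `sin(φ_v − φ_u) = −sin(φ_u − φ_v)` at the level of tables. -/
theorem sinTab_swap_apply (u v : W 2) (n : Freq 2) : sinTab v u n = -sinTab u v n := by
  simp only [sinTab, Finsupp.add_apply, Finsupp.single_apply]
  split_ifs <;> ring

/-- the `1 − cos` table has real coefficients. -/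
theorem conj_cosTab_apply (u v : W 2) (n : Freq 2) : conj (cosTab u v n) = cosTab u v n := by
  simp only [cosTab, Finsupp.add_apply, Finsupp.single_apply, map_add, apply_ite conj, map_one, map_zero,
    map_neg, map_div₀, map_ofNat]

/-- the `sin` table has purely imaginary coefficients. -/
theorem conj_sinTab_apply (u v : W 2) (n : Freq 2) : conj (sinTab u v n) = -sinTab u v n := by
  simp only [sinTab, Finsupp.add_apply, Finsupp.single_apply, map_add, apply_ite conj, map_zero,
    map_neg, map_div₀, map_ofNat, Complex.conj_I]
  split_ifs <;> ring


/-- **(R) for the Berry-tilted XY table.** -/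
theorem witness_timeReflection (ε₂ : ℝ) (n : Freq 2) :
    witness 0 ε₂ (fun w => n (w.1, w.2.1, Fin.rev w.2.2)) = conj (witness 0 ε₂ (-n)) := by
  have rev0 : Fin.rev (0 : Fin 2) = 1 := by decide
  have rev1 : Fin.rev (1 : Fin 2) = 0 := by decide
  have hc := cosTab_apply_comp (ρ := fun w : W 2 => ((w.1, w.2.1, Fin.rev w.2.2) : W 2)) rhoR_invol
  have hs := sinTab_apply_comp (ρ := fun w : W 2 => ((w.1, w.2.1, Fin.rev w.2.2) : W 2)) rhoR_invol
  simp only [witness, spatialTab, temporalCosTab, temporalSinTab, spatialEdges, temporalEdges, vx,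
    List.map_cons, List.map_nil, List.sum_cons, List.sum_nil,
    Finsupp.coe_add, Finsupp.coe_smul, Pi.add_apply, Pi.smul_apply, smul_eq_mul,
    hc, hs, cosTab_apply_neg, sinTab_apply_neg, rev0, rev1,
    map_add, map_mul, map_neg, conj_cosTab_apply, conj_sinTab_apply, map_one, Complex.conj_I,
    Complex.conj_ofReal, Complex.ofReal_zero, mul_zero, add_zero, neg_neg]
  rw [cosTab_comm ((0,0,0) : W 2) (0,0,1), cosTab_comm ((0,1,0) : W 2) (0,1,1), cosTab_comm ((1,0,0) : W 2) (1,0,1),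
    cosTab_comm ((1,1,0) : W 2) (1,1,1),
    sinTab_swap_apply ((0,0,1) : W 2) (0,0,0) n, sinTab_swap_apply ((0,1,1) : W 2) (0,1,0) n,
    sinTab_swap_apply ((1,0,1) : W 2) (1,0,0) n, sinTab_swap_apply ((1,1,1) : W 2) (1,1,0) n]
  ring

/-- **(P) for the Berry-tilted XY table.** -/
theorem witness_inversion (ε₂ : ℝ) (n : Freq 2) :
    witness 0 ε₂ (fun w => n (Fin.rev w.1, Fin.rev w.2.1, w.2.2)) = witness 0 ε₂ n := by
  have rev0 : Fin.rev (0 : Fin 2) = 1 := by decide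
  have rev1 : Fin.rev (1 : Fin 2) = 0 := by decide
  have hc := cosTab_apply_comp (ρ := fun w : W 2 => ((Fin.rev w.1, Fin.rev w.2.1, w.2.2) : W 2)) rhoP_invol
  have hs := sinTab_apply_comp (ρ := fun w : W 2 => ((Fin.rev w.1, Fin.rev w.2.1, w.2.2) : W 2)) rhoP_invol
  simp only [witness, spatialTab, temporalCosTab, temporalSinTab, spatialEdges, temporalEdges, vx,
    List.map_cons, List.map_nil, List.sum_cons, List.sum_nil,
    Finsupp.coe_add, Finsupp.coe_smul, Pi.add_apply, Pi.smul_apply, smul_eq_mul,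
    hc, hs, rev0, rev1, add_zero]
  rw [cosTab_comm ((0,1,0) : W 2) (1,1,0), cosTab_comm ((0,1,1) : W 2) (1,1,1), cosTab_comm ((0,0,0) : W 2) (1,0,0),
    cosTab_comm ((0,0,1) : W 2) (1,0,1), cosTab_comm ((1,0,0) : W 2) (1,1,0), cosTab_comm ((1,0,1) : W 2) (1,1,1),
    cosTab_comm ((0,0,0) : W 2) (0,1,0), cosTab_comm ((0,0,1) : W 2) (0,1,1)]
  ring

/-- the imaginary part of the tilted table's generating function: `ε₂ · Σ_{temporal edges} sin Δ_eφ`. -/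
theorem genF_tiltedXY_im (ε₂ : ℝ) (φ : W 2 → ℝ) :
    (genF (witness 0 ε₂) φ).im = ε₂ * (Real.sin (φ (0,0,1) - φ (0,0,0)) + Real.sin (φ (0,1,1) - φ (0,1,0)) +
      Real.sin (φ (1,0,1) - φ (1,0,0)) + Real.sin (φ (1,1,1) - φ (1,1,0))) := by
  simp only [witness, spatialTab, temporalCosTab, temporalSinTab, spatialEdges, temporalEdges,
    List.map_cons, List.map_nil, List.sum_cons, List.sum_nil, genF_add, genF_smul,
    genF_cosTab, genF_sinTab, vx, add_zero, Complex.add_re, Complex.add_im,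
    Complex.mul_re, Complex.mul_im, Complex.ofReal_re, Complex.ofReal_im, Complex.I_re, Complex.I_im,
    Complex.one_re, Complex.one_im]
  ring

/-- The tilted table is GENUINELY COMPLEX for `ε₂ ≠ 0`: its generating function takes a non-real value
(at the configuration `φ = π/2` on the later slice, `0` on the earlier one, `Im F = 4ε₂`). -/
theorem genF_tiltedXY_not_real {ε₂ : ℝ} (hε : ε₂ ≠ 0) :
    ∃ φ : W 2 → ℝ, (genF (witness 0 ε₂) φ).im ≠ 0 := by
  refine ⟨fun w => if w.2.2 = 1 then Real.pi / 2 else 0, ?_⟩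
  rw [genF_tiltedXY_im]
  norm_num [Real.sin_pi_div_two, hε]

/-- **The restated class is inhabited by a genuinely complex table.**  For `|ε₂| ≤ 1/5` the Berry-tilted XY table
`witness 0 ε₂` satisfies the six hypotheses of `Theses.BalabanIR.BirComplexStableXYR` at `r = 2`, `B = 128`,
`c₀ = 1/18`, spelled out verbatim: (U1), (N), (A), (C), (R), (P). -/
theorem tiltedXY_mem_classRP {ε₂ : ℝ} (h₂ : |ε₂| ≤ 1/5) :
    (∀ m ∈ (witness 0 ε₂).support, ∑ w, m w = 0) ∧
    (witness 0 ε₂).sum (fun _ a => a) = 0 ∧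
    (witness 0 ε₂).sum (fun n a => ‖a‖ * Real.exp (∑ w, |(n w : ℝ)|)) ≤ 128 ∧
    (∀ φ : W 2 → ℝ, (1/18 : ℝ) * ∑ w, ∑ w', (1 - Real.cos (φ w - φ w')) ≤ (genF (witness 0 ε₂) φ).re) ∧
    (∀ n : Freq 2, witness 0 ε₂ (fun w => n (w.1, w.2.1, Fin.rev w.2.2)) = (starRingEnd ℂ) (witness 0 ε₂ (-n))) ∧
    (∀ n : Freq 2, witness 0 ε₂ (fun w => n (Fin.rev w.1, Fin.rev w.2.1, w.2.2)) = witness 0 ε₂ n) := by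
  have h₁ : |(0:ℝ)| ≤ 1 := by norm_num
  obtain ⟨hU, hN, hA, hC⟩ := witness_admissible h₁ h₂
  exact ⟨hU, hN, hA, hC, witness_timeReflection ε₂, witness_inversion ε₂⟩

end

end Summit.HubbardSuperconductivity.HubbardSuperconductivity.Theorems.BirComplexStableXYR.Negative
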